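import Mathlib
import Literature.Analysis.FluidPDE.BeltramiFlows
import Literature.Analysis.FluidPDE.DecayingSelfSimilarEulerProfile
import Literature.Analysis.FluidPDE.NSLerayHopfABCEigenmode
import Literature.Analysis.FluidPDE.SteadyNSRingCorrector
import HarnessLib

/-!
# Linearisation of Navier–Stokes about a (forced) strong Beltrami host: the polarised Lamb
# identity, the exact `−νλ̄²` Beltrami directions, the exact forced two-field solution, and the
# eigenmode identity at a stagnation point

HONEST FRAMING (cell `ns-blowup`, seat `ns-blowup-instab`, human ruling D-0035): nothing here is
a claim about Navier–Stokes blow-up. WHAT THIS IS NOT: not a statement about the marginal tower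
N1*; it is the EXACT pointwise calculus behind two rows of the cell's census of the MODEL host
(the forced ABC / strong-Beltrami flow): refuter KILLSHEET §XIII.0 («Beltrami sextuplet») and
instab RATE-AUDIT §6.6.4(c) (CLAIM A6, «eigenmode identity at the stagnation point»), until now
graded EXACT on paper only.

* §1 **Polarised Lamb identity** (`convect_add_convect_eq_cross_add_gradient`): for `v, w : (EuclideanSpace ℝ (Fin 3)) → (EuclideanSpace ℝ (Fin 3))`
  differentiable at `x`,
  `(v·∇)w + (w·∇)v = (curl v) × w + (curl w) × v + ∇(v·w)` at `x`
  — the polarisation of the tree's Lamb form `(v·∇)v = (curl v) × v + ∇(½|v|²)`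
  (`Literature.Analysis.FluidPDE.convect_self_eq_cross_curl_add_gradient`), i.e. the classical
  `∇(A·B) = (A·∇)B + (B·∇)A + A × curl B + B × curl A` (Majda–Bertozzi 2002, §1.1).
* §2 **Beltrami pair** (`convect_add_convect_eq_gradient_of_curl_eq_smul`,
  `IsBeltrami.linearisedAdvection_eq_gradient`): if `curl v = λ v` and `curl w = λ w` at `x` with the
  SAME `λ`, the cross terms cancel (`λ(v × w + w × v) = 0`) and the linearised advection
  `(v·∇)w + (w·∇)v = ∇(v·w)` is a pure gradient. Hence (§3, `linearisedNS_strongBeltrami`) for a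
  strong Beltrami host `U` (`curl U = λ̄U`) and a strong Beltrami direction `b` with the same `λ̄`
  (`Δb = −λ̄²b`): `−[(U·∇)b + (b·∇)U] + νΔb = −νλ̄² b − ∇(U·b)` — modulo gradients (Leray
  projection) `b` is an EXACT eigenvector of the linearised operator with eigenvalue `−νλ̄²`
  (`= −ν` for the ABC host, `λ̄ = 1`; KILLSHEET XIII.0: "L₀b = νΔb = −νb … an EXACT eigenvalue of
  L₀ … with DELOCALISED steady eigenfunctions").
* §4 **Exact forced solution** (`isClassicalNSSolutionOn_forcedHost`, `isClassicalNSSolutionOn_host`;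
  ABC instance `isClassicalNSSolutionOn_abc_forcedHost`): with the steady force `f = νλ̄²U` that maintains the
  host, `u(t) = U + e^{−νλ̄²t} b`, `p = −½|u|²` is a classical solution of the FORCED Navier–Stokes
  system on `(EuclideanSpace ℝ (Fin 3)) × ℝ` for every amplitude of `b` (the tree's `IsClassicalNSSolutionOn univ ν f u p`,
  Fefferman's (1)–(2) with force) — KILLSHEET XIII.0 "NONLINEAR form: u(t) = U + e^{−νt}b solves
  the forced NS EXACTLY … an invariant family decaying onto U at rate ν; it can never be an X0
  object". (The unforced all-decaying case `e^{−νλ̄²t}(U + b)` is the tree's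
  `isClassicalNSSolutionOn_strongBeltrami`, MB p. 61.)
* §5 **Eigenmode identity at a stagnation point** (CLAIM A6; `eigenmode_identity`,
  `eigenmode_identity_beltrami`, `eigenmode_identity_component`, `eigenvalue_of_beltrami_mode`):
  if the linearised vorticity balance of a normal mode `(ũ, ω̃)e^{γt}` about a steady host
  `(U, Ω̄)`, `γω̃ = −(U·∇)ω̃ − (ũ·∇)Ω̄ + (Ω̄·∇)ũ + (ω̃·∇)U + R` (`R = νΔω̃`), holds at a point `x₀`
  with `U(x₀) = 0`, `Ω̄(x₀) = 0`, then `γω̃(x₀) = DU(x₀)ω̃(x₀) − DΩ̄(x₀)ũ(x₀) + R`; for a Beltrami host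
  `Ω̄ = λ̄U`: `γω̃(x₀) = DU(x₀)(ω̃(x₀) − λ̄ũ(x₀)) + R`, and along an eigen-direction `e` of `DU(x₀)ᵀ`
  with rate `σ`: `(σ − γ)ω̃·e = σλ̄ ũ·e − R·e` (RATE-AUDIT 6.6.4(c) verbatim); consistency with §3:
  a mode that is itself Beltrami-`λ̄` at `x₀` with `R = −νλ̄²ω̃(x₀)` and `ω̃(x₀) ≠ 0` has `γ = −νλ̄²`.
* §6 (`adjoint_fderiv_apply_self`, `IsBeltrami.convect_sub_adjoint_apply_eq_zero`): `DU(x)ᵀU(x) =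
  ∇(½|U|²)(x)` for any field, so for a Beltrami host `(U·∇)U − (∇U)ᵀU = 0` — the advective part of
  the ADJOINT linearisation annihilates the host itself (KILLSHEET XIII.0: "L₀* preserves U … since
  both brackets equal ∇|U|²/2").

All statements are pointwise identities over the tree's `convect`, `curl`, `cross`, `gradient`,
`IsBeltrami`, `ABC.abc`, `IsClassicalNSSolutionOn`; no integration, no spectral theory, no claim
about the rest of the spectrum. References: A. J. Majda, A. L. Bertozzi, *Vorticity and
Incompressible Flow* (CUP 2002), §1.1, §2.1 (2.5), §2.3.2; V. I. Arnold, *C. R. Acad. Sci. Paris*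
261 (1965) 17–20 (ABC flows); cell files `KILLSHEET.md` §XIII.0, `instab/RATE-AUDIT.md` §6.6.4.
-/

noncomputable section

open Set Real InnerProductSpace
open scoped RealInnerProductSpace ContDiff Laplacian Topology

namespace Summit.NavierStokesRegularity.FluidComputer.BeltramiHostLinearisation

open Literature.Analysis.FluidPDE

/-! ### §1 The polarised Lamb identity -/

/-- `⟪∇f(x), h⟫ = Df(x) h` (unfolding Mathlib's `gradient`). -/
theorem inner_gradient_left {F : Type*} [NormedAddCommGroup F] [InnerProductSpace ℝ F]
    [CompleteSpace F] (f : F → ℝ) (x h : F) : ⟪gradient f x, h⟫ = fderiv ℝ f x h := by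
  rw [gradient, toDual_symm_apply]

/-- `(c a) × b + (c b) × a = 0` (antisymmetry of the cross product). -/
theorem cross_smul_add_cross_smul (c : ℝ) (a b : (EuclideanSpace ℝ (Fin 3))) :
    cross (c • a) b + cross (c • b) a = 0 := by
  ext i
  fin_cases i <;> simp [cross, cross_apply] <;> ring

/-- **Polarised Lamb identity.** For `v, w : (EuclideanSpace ℝ (Fin 3)) → (EuclideanSpace ℝ (Fin 3))` differentiable at `x`,
`(v·∇)w + (w·∇)v = (curl v) × w + (curl w) × v + ∇(v·w)` at `x` (Majda–Bertozzi §1.1: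
`∇(A·B) = (A·∇)B + (B·∇)A + A × curl B + B × curl A`; the tree's Lamb form
`convect_self_eq_cross_curl_add_gradient` is the diagonal `v = w`). Proof: test against an
arbitrary `h` and use `⟪(curl U) × a, b⟫ = ⟪b, DU a⟫ − ⟪a, DU b⟫` (`inner_cross_curl_left`) and
`D(v·w)h = ⟪v, Dw h⟫ + ⟪Dv h, w⟫`. -/
theorem convect_add_convect_eq_cross_add_gradient {v w : (EuclideanSpace ℝ (Fin 3)) → (EuclideanSpace ℝ (Fin 3))} {x : (EuclideanSpace ℝ (Fin 3))}
    (hv : DifferentiableAt ℝ v x) (hw : DifferentiableAt ℝ w x) :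
    convect v w x + convect w v x =
      cross (curl v x) (w x) + cross (curl w x) (v x) + gradient (fun y => ⟪v y, w y⟫) x := by
  apply ext_inner_right ℝ
  intro h
  rw [inner_add_left, inner_add_left, inner_add_left, convect_apply, convect_apply,
    inner_cross_curl_left, inner_cross_curl_left, inner_gradient_left,
    fderiv_inner_apply ℝ hv hw]
  rw [real_inner_comm (fderiv ℝ v x (w x)) h, real_inner_comm (fderiv ℝ w x (v x)) h,
    real_inner_comm (w x) (fderiv ℝ v x h)]
  ring

/-! ### §2 A Beltrami pair: the linearised advection is a pure gradient -/

/-- **Beltrami pair, pointwise form.** If `curl v (x) = λ v(x)` and `curl w (x) = λ w(x)` with the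
same `λ`, then `(v·∇)w + (w·∇)v = ∇(v·w)` at `x`: the cross terms of the polarised Lamb identity
are `λ(v × w + w × v) = 0` (KILLSHEET XIII.0: "identity ∇(U·b) = (U·∇)b + (b·∇)U + U×curl b +
b×curl U, and U×b + b×U = 0"). -/
theorem convect_add_convect_eq_gradient_of_curl_eq_smul {v w : (EuclideanSpace ℝ (Fin 3)) → (EuclideanSpace ℝ (Fin 3))} {x : (EuclideanSpace ℝ (Fin 3))} {lam : ℝ}
    (hv : DifferentiableAt ℝ v x) (hw : DifferentiableAt ℝ w x)
    (hcv : curl v x = lam • v x) (hcw : curl w x = lam • w x) :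
    convect v w x + convect w v x = gradient (fun y => ⟪v y, w y⟫) x := by
  rw [convect_add_convect_eq_cross_add_gradient hv hw, hcv, hcw, cross_smul_add_cross_smul,
    zero_add]

/-- **Beltrami pair** for the tree's `IsBeltrami` (common coefficient function `λ(x)`): the
linearised advection of `w` about `v` (and vice versa) is the gradient `∇(v·w)`, hence invisible
to the Leray projection. -/
theorem _root_.Literature.Analysis.FluidPDE.IsBeltrami.linearisedAdvection_eq_gradient
    {v w : (EuclideanSpace ℝ (Fin 3)) → (EuclideanSpace ℝ (Fin 3))} {lam : (EuclideanSpace ℝ (Fin 3)) → ℝ} (hv : IsBeltrami v lam) (hw : IsBeltrami w lam) {x : (EuclideanSpace ℝ (Fin 3))}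
    (hvx : DifferentiableAt ℝ v x) (hwx : DifferentiableAt ℝ w x) :
    convect v w x + convect w v x = gradient (fun y => ⟪v y, w y⟫) x :=
  convect_add_convect_eq_gradient_of_curl_eq_smul hvx hwx (hv x) (hw x)

/-! ### §3 The linearised Navier–Stokes operator on a strong Beltrami direction -/

/-- **The exact `−νλ̄²` directions** (KILLSHEET XIII.0, "L₀b = νΔb = −νb"). For a strong Beltrami
host `U` (`curl U = λ̄U`, differentiable) and a strong Beltrami direction `b` with the SAME `λ̄`
(`C²`, divergence free, so `Δb = −λ̄²b` by the tree's `laplacian_eq_of_strongBeltrami`):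
`−[(U·∇)b + (b·∇)U] + νΔb = −νλ̄² b − ∇(U·b)` at every point — modulo gradients, `b` is an exact
eigenvector of the linearised operator with eigenvalue `−νλ̄²`, for every amplitude pattern of `U`. -/
theorem linearisedNS_strongBeltrami {U b : (EuclideanSpace ℝ (Fin 3)) → (EuclideanSpace ℝ (Fin 3))} {lam0 : ℝ} (ν : ℝ)
    (hU : IsBeltrami U fun _ => lam0) (hb : IsBeltrami b fun _ => lam0)
    (hUd : Differentiable ℝ U) (hb2 : ContDiff ℝ 2 b) (hbdiv : VectorCalculus.IsDivFree b)
    (x : (EuclideanSpace ℝ (Fin 3))) :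
    -(convect U b x + convect b U x) + ν • (Δ b) x =
      (-(ν * lam0 ^ 2)) • b x - gradient (fun y => ⟪U y, b y⟫) x := by
  rw [hU.linearisedAdvection_eq_gradient hb (hUd x) ((hb2.differentiable (by simp)) x),
    laplacian_eq_of_strongBeltrami hb hb2 hbdiv x, smul_smul, mul_neg, neg_add_eq_sub]

/-- The ABC host (`λ̄ = 1`): for every strong Beltrami-`1` direction `b` (e.g. any member of the ABC
family, `ABC.isBeltrami_abc`), `−[(U·∇)b + (b·∇)U] + νΔb = −ν b − ∇(U·b)` with `U = abc A B C` —
the exact eigenvalue `−ν` (`= −1/R` in the cell's units) of KILLSHEET XIII.0. -/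
theorem linearisedNS_abc {b : (EuclideanSpace ℝ (Fin 3)) → (EuclideanSpace ℝ (Fin 3))} (ν A B C : ℝ) (hb : IsBeltrami b fun _ => 1)
    (hb2 : ContDiff ℝ 2 b) (hbdiv : VectorCalculus.IsDivFree b) (x : (EuclideanSpace ℝ (Fin 3))) :
    -(convect (ABC.abc A B C) b x + convect b (ABC.abc A B C) x) + ν • (Δ b) x =
      (-ν) • b x - gradient (fun y => ⟪ABC.abc A B C y, b y⟫) x := by
  have h := linearisedNS_strongBeltrami ν (ABC.isBeltrami_abc A B C) hb
    (ABC.differentiable_abc A B C) hb2 hbdiv x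
  simpa using h

/-- Instance: a second ABC field `b = abc A' B' C'` is such a direction about `U = abc A B C`. -/
theorem linearisedNS_abc_abc (ν A B C A' B' C' : ℝ) (x : (EuclideanSpace ℝ (Fin 3))) :
    -(convect (ABC.abc A B C) (ABC.abc A' B' C') x + convect (ABC.abc A' B' C') (ABC.abc A B C) x) +
        ν • (Δ (ABC.abc A' B' C')) x =
      (-ν) • ABC.abc A' B' C' x - gradient (fun y => ⟪ABC.abc A B C y, ABC.abc A' B' C' y⟫) x :=
  linearisedNS_abc ν A B C (ABC.isBeltrami_abc A' B' C') (ABC.contDiff_abc A' B' C')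
    (ABC.isDivFree_abc A' B' C') x

/-! ### §4 The exact forced solution `U + e^{−νλ̄²t} b` -/

/-- Homogeneity of the divergence at a point of differentiability. -/
theorem divergence_const_smul_of_differentiableAt {f : (EuclideanSpace ℝ (Fin 3)) → (EuclideanSpace ℝ (Fin 3))} {x : (EuclideanSpace ℝ (Fin 3))}
    (hf : DifferentiableAt ℝ f x) (c : ℝ) :
    VectorCalculus.divergence (fun y => c • f y) x = c * VectorCalculus.divergence f x := by
  simp only [VectorCalculus.divergence, fderiv_fun_const_smul hf c,
    ContinuousLinearMap.toLinearMap_smul, map_smul, smul_eq_mul]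

/-- **KILLSHEET XIII.0, nonlinear form — the exact forced two-field solution.** Let `U` and `b` be
smooth, divergence-free strong Beltrami fields on `(EuclideanSpace ℝ (Fin 3))` with the SAME constant `λ̄`
(`curl U = λ̄U`, `curl b = λ̄b`). Then for every viscosity `ν`, with the steady force `f = νλ̄²U`
(which makes `U` itself a steady forced solution), the pair
`u(t,x) = U(x) + e^{−νλ̄²t} b(x)`, `p(t,x) = −½|u(t,x)|²` is a classical solution of the forced
incompressible Navier–Stokes system on `(EuclideanSpace ℝ (Fin 3)) × ℝ`: `u(t)` is Beltrami-`λ̄` at each `t`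
(linearity of the Beltrami condition), so `(u·∇)u = ∇(½|u|²) = −∇p` and `νΔu = −νλ̄²u`, while
`∂ₜu = −νλ̄² e^{−νλ̄²t} b` and `f` cancels `−νλ̄²U`. The family is invariant for every amplitude of
`b` and decays onto the host at the rate `νλ̄²`. -/
theorem isClassicalNSSolutionOn_forcedHost {U b : EuclideanSpace ℝ (Fin 3) → EuclideanSpace ℝ (Fin 3)}
    {lam0 : ℝ} (ν : ℝ) (hU : IsBeltrami U fun _ => lam0) (hb : IsBeltrami b fun _ => lam0)
    (hUs : ContDiff ℝ ∞ U) (hbs : ContDiff ℝ ∞ b)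
    (hUdiv : VectorCalculus.IsDivFree U) (hbdiv : VectorCalculus.IsDivFree b) :
    IsClassicalNSSolutionOn univ ν (fun _ x => (ν * lam0 ^ 2) • U x)
      (fun t x => U x + exp (-(lam0 ^ 2 * ν) * t) • b x)
      (fun t x => -(‖U x + exp (-(lam0 ^ 2 * ν) * t) • b x‖ ^ 2 / 2)) := by
  have hUd : Differentiable ℝ U := hUs.differentiable (by simp)
  have hbd : Differentiable ℝ b := hbs.differentiable (by simp)
  -- joint smoothness of the velocity
  have hsu : ContDiff ℝ ∞ (fun q : ℝ × EuclideanSpace ℝ (Fin 3) =>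
      U q.2 + exp (-(lam0 ^ 2 * ν) * q.1) • b q.2) :=
    (hUs.comp contDiff_snd).add
      ((contDiff_exp.comp (contDiff_const.mul contDiff_fst)).smul (hbs.comp contDiff_snd))
  refine ⟨hsu.contDiffOn, (((hsu.norm_sq ℝ).div_const 2).neg).contDiffOn, ?_, ?_⟩
  · -- the momentum equation
    intro t _ x
    set c : ℝ := exp (-(lam0 ^ 2 * ν) * t) with hc
    -- the slice `u(t)` is a smooth divergence-free strong Beltrami field
    have hut : IsBeltrami (fun y => U y + c • b y) fun _ => lam0 :=
      hU.add (hb.const_smul hbd c) hUd (hbd.const_smul c)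
    have huts : ContDiff ℝ ∞ (fun y => U y + c • b y) := hUs.add (hbs.const_smul c)
    have hut2 : ContDiff ℝ 2 (fun y => U y + c • b y) := contDiff_infty.1 huts 2
    have hutd : DifferentiableAt ℝ (fun y => U y + c • b y) x := (huts.differentiable (by simp)) x
    have hcbd : Differentiable ℝ (fun y => c • b y) := (hbs.const_smul c).differentiable (by simp)
    have hutdiv : VectorCalculus.IsDivFree (fun y => U y + c • b y) := fun y => by
      rw [RingCorrector.divergence_add (hUd y) (hcbd y),
        divergence_const_smul_of_differentiableAt (hbd y) c, hUdiv y, hbdiv y, mul_zero, add_zero]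
    -- time derivative
    have h1 : timeDerivWithin univ (fun s y => U y + exp (-(lam0 ^ 2 * ν) * s) • b y) t x =
        (c * (-(lam0 ^ 2 * ν))) • b x := by
      rw [timeDerivWithin_apply, derivWithin_univ]
      have hd : HasDerivAt (fun s : ℝ => -(lam0 ^ 2 * ν) * s) (-(lam0 ^ 2 * ν)) t := by
        simpa using (hasDerivAt_id t).const_mul (-(lam0 ^ 2 * ν))
      have h := (hasDerivAt_const t (U x)).add (hd.exp.smul_const (b x))
      simp only [zero_add] at h
      exact h.deriv
    -- convective term
    have h2 : convect (fun y => U y + c • b y) (fun y => U y + c • b y) x =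
        gradient (fun y => ‖U y + c • b y‖ ^ 2 / 2) x := hut.convect_eq_gradient hutd
    -- viscous term
    have h3 : Δ (fun y => U y + c • b y) x = -(lam0 ^ 2) • (U x + c • b x) :=
      laplacian_eq_of_strongBeltrami hut hut2 hutdiv x
    -- pressure term
    have h4 : gradient (fun y => -(‖U y + c • b y‖ ^ 2 / 2)) x =
        -gradient (fun y => ‖U y + c • b y‖ ^ 2 / 2) x := gradient_fun_neg' _ x
    rw [h1, h2, h3, h4]
    simp only [smul_add, smul_smul, sub_neg_eq_add]
    ext i
    simp only [PiLp.add_apply, PiLp.smul_apply, smul_eq_mul]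
    ring
  · -- incompressibility
    intro t _ y
    have hcbd : Differentiable ℝ (fun z => exp (-(lam0 ^ 2 * ν) * t) • b z) :=
      (hbs.const_smul _).differentiable (by simp)
    show VectorCalculus.divergence (fun z => U z + exp (-(lam0 ^ 2 * ν) * t) • b z) y = 0
    rw [RingCorrector.divergence_add (hUd y) (hcbd y),
      divergence_const_smul_of_differentiableAt (hbd y), hUdiv y, hbdiv y, mul_zero, add_zero]

/-- The host alone (`b = 0`): a smooth divergence-free strong Beltrami field `U` with pressure
`−½|U|²` is a STEADY solution of Navier–Stokes with the force `νλ̄²U` — the forced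
strong-Beltrami (e.g. forced ABC) host of the cell's lane N1*. -/
theorem isClassicalNSSolutionOn_host {U : EuclideanSpace ℝ (Fin 3) → EuclideanSpace ℝ (Fin 3)}
    {lam0 : ℝ} (ν : ℝ) (hU : IsBeltrami U fun _ => lam0) (hUs : ContDiff ℝ ∞ U)
    (hUdiv : VectorCalculus.IsDivFree U) :
    IsClassicalNSSolutionOn univ ν (fun _ x => (ν * lam0 ^ 2) • U x) (fun _ => U)
      (fun _ x => -(‖U x‖ ^ 2 / 2)) := by
  have hb0 : IsBeltrami (fun _ : EuclideanSpace ℝ (Fin 3) => (0 : EuclideanSpace ℝ (Fin 3)))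
      fun _ => lam0 := fun x => by simp
  have hdiv0 : VectorCalculus.IsDivFree
      (fun _ : EuclideanSpace ℝ (Fin 3) => (0 : EuclideanSpace ℝ (Fin 3))) := fun x => by
    simp [VectorCalculus.divergence]
  have h := isClassicalNSSolutionOn_forcedHost ν hU hb0 hUs contDiff_const hUdiv hdiv0
  simp only [smul_zero, add_zero] at h
  exact h

/-- **The forced ABC host and its sextuplet directions** (KILLSHEET XIII.0 for `U = abc A B C`,
`λ̄ = 1`, `f = νU`): for any second member `b = abc A' B' C'` of the ABC family (three of the six
real dimensions of the `(+)`-helical `|k| = 1` shell; the other three are its translates),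
`u(t) = abc A B C + e^{−νt} abc A' B' C'` with `p = −½|u|²` solves the Navier–Stokes system with
force `ν · abc A B C` exactly on `ℝ³ × ℝ`, for every `ν` and all amplitudes: an invariant family
decaying onto the host at rate `ν`, never a growing (X0) direction. -/
theorem isClassicalNSSolutionOn_abc_forcedHost (ν A B C A' B' C' : ℝ) :
    IsClassicalNSSolutionOn univ ν (fun _ x => ν • ABC.abc A B C x)
      (fun t x => ABC.abc A B C x + exp (-(ν * t)) • ABC.abc A' B' C' x)
      (fun t x => -(‖ABC.abc A B C x + exp (-(ν * t)) • ABC.abc A' B' C' x‖ ^ 2 / 2)) := by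
  have h := isClassicalNSSolutionOn_forcedHost ν (ABC.isBeltrami_abc A B C)
    (ABC.isBeltrami_abc A' B' C') (ABC.contDiff_abc A B C) (ABC.contDiff_abc A' B' C')
    (ABC.isDivFree_abc A B C) (ABC.isDivFree_abc A' B' C')
  simp only [one_pow, mul_one, one_mul, neg_mul] at h
  exact h

/-! ### §5 The eigenmode identity at a stagnation point (CLAIM A6) -/

section Eigenmode

variable {E : Type*} [NormedAddCommGroup E] [InnerProductSpace ℝ E]

/-- **A6, general steady host.** If the linearised vorticity balance of a normal mode
`(ũ, ω̃)e^{γt}` about a steady host `(U, Ω̄)`,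
`γ ω̃ = −(U·∇)ω̃ − (ũ·∇)Ω̄ + (Ω̄·∇)ũ + (ω̃·∇)U + R` (`R` = the viscous remainder `νΔω̃(x₀)`; the
force is fixed, so it does not enter the linearisation), holds at a point `x₀` where `U(x₀) = 0`
and `Ω̄(x₀) = 0` (a stagnation point of a steady Euler / Beltrami host, cf.
`StagnationPointIdentities.eq_zero_of_steady_inviscid`), then the two transport terms drop and
`γ ω̃(x₀) = DU(x₀) ω̃(x₀) − DΩ̄(x₀) ũ(x₀) + R`. -/
theorem eigenmode_identity {U Ω ut ωt : E → E} {x₀ R : E} {γ : ℝ}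
    (hbal : γ • ωt x₀ =
      -(convect U ωt x₀) - convect ut Ω x₀ + convect Ω ut x₀ + convect ωt U x₀ + R)
    (hU : U x₀ = 0) (hΩ : Ω x₀ = 0) :
    γ • ωt x₀ = fderiv ℝ U x₀ (ωt x₀) - fderiv ℝ Ω x₀ (ut x₀) + R := by
  rw [hbal, convect_apply, convect_apply, convect_apply, convect_apply, hU, hΩ, map_zero, map_zero]
  abel

/-- **A6, Beltrami host** (`Ω̄ = λ̄U`, RATE-AUDIT 6.6.4(c)): `γ ω̃(x₀) = DU(x₀)(ω̃(x₀) − λ̄ ũ(x₀)) + R`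
— at the stagnation point the growth rate sees only the strain `A = DU(x₀)` acting on the
combination `ω̃ − λ̄ũ`, plus the viscous remainder. -/
theorem eigenmode_identity_beltrami {U ut ωt : E → E} {x₀ R : E} {γ lam : ℝ}
    (hUd : DifferentiableAt ℝ U x₀)
    (hbal : γ • ωt x₀ =
      -(convect U ωt x₀) - convect ut (fun y => lam • U y) x₀ + convect (fun y => lam • U y) ut x₀ +
        convect ωt U x₀ + R)
    (hU : U x₀ = 0) :
    γ • ωt x₀ = fderiv ℝ U x₀ (ωt x₀ - lam • ut x₀) + R := by
  have hΩ : (fun y => lam • U y) x₀ = 0 := by simp [hU]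
  rw [eigenmode_identity hbal hU hΩ, fderiv_fun_const_smul hUd, map_sub, map_smul]
  rfl

/-- **A6 along a principal strain direction** (RATE-AUDIT 6.6.4(c): "along e₁:
(σ₁ − γ)ω̃₁(x_α) = σ₁λũ₁(x_α) − νΔω̃₁(x_α)"). If moreover `e` is an eigen-direction of `DU(x₀)ᵀ` with
rate `σ` (`⟪DU(x₀)v, e⟫ = σ⟪v, e⟫` for all `v`; for the SYMMETRIC strain at a steady-Euler
stagnation point this is an eigenvector of `DU(x₀)`), then the `e`-components satisfy
`(σ − γ) ω̃·e = σλ̄ ũ·e − R·e`. -/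
theorem eigenmode_identity_component {U ut ωt : E → E} {x₀ R e : E} {γ lam σ : ℝ}
    (hUd : DifferentiableAt ℝ U x₀)
    (hbal : γ • ωt x₀ =
      -(convect U ωt x₀) - convect ut (fun y => lam • U y) x₀ + convect (fun y => lam • U y) ut x₀ +
        convect ωt U x₀ + R)
    (hU : U x₀ = 0) (he : ∀ v, ⟪fderiv ℝ U x₀ v, e⟫ = σ * ⟪v, e⟫) :
    (σ - γ) * ⟪ωt x₀, e⟫ = σ * lam * ⟪ut x₀, e⟫ - ⟪R, e⟫ := by
  have h := congrArg (fun z => ⟪z, e⟫) (eigenmode_identity_beltrami hUd hbal hU)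
  simp only [inner_add_left, inner_smul_left, he, inner_sub_left, RCLike.conj_to_real] at h
  linarith

/-- **Consistency of A6 with the sextuplet** (KILLSHEET XIII.1: "instance of A6 with ũ = ω̃ = b,
γ = −ν"). If the mode is itself Beltrami-`λ̄` at `x₀` (`ω̃(x₀) = λ̄ ũ(x₀)`, e.g. `ũ = b` a strong
Beltrami direction) and the remainder is `R = −νλ̄² ω̃(x₀)` (`Δb = −λ̄²b`), then
`(γ + νλ̄²) ω̃(x₀) = 0`; so `γ = −νλ̄²` as soon as `ω̃(x₀) ≠ 0`. -/
theorem eigenvalue_of_beltrami_mode {U ut ωt : E → E} {x₀ : E} {γ lam ν : ℝ}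
    (hUd : DifferentiableAt ℝ U x₀)
    (hbal : γ • ωt x₀ =
      -(convect U ωt x₀) - convect ut (fun y => lam • U y) x₀ + convect (fun y => lam • U y) ut x₀ +
        convect ωt U x₀ + (-(ν * lam ^ 2)) • ωt x₀)
    (hU : U x₀ = 0) (hmode : ωt x₀ = lam • ut x₀) (hne : ωt x₀ ≠ 0) :
    γ = -(ν * lam ^ 2) := by
  have h := eigenmode_identity_beltrami hUd hbal hU
  rw [hmode, sub_self, map_zero, zero_add, ← hmode] at h
  have h' : (γ - -(ν * lam ^ 2)) • ωt x₀ = 0 := by rw [sub_smul, h, sub_self]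
  rcases smul_eq_zero.1 h' with h0 | h0
  · linarith
  · exact absurd h0 hne

end Eigenmode

/-! ### §6 The adjoint direction: `(U·∇)U − (∇U)ᵀU = 0` for a Beltrami host -/

/-- `DU(x)ᵀ U(x) = ∇(½|U|²)(x)` for any field differentiable at `x` (both pair with `h` to
`⟪U(x), DU(x)h⟫`; tree: `hasFDerivAt_half_norm_sq`). -/
theorem adjoint_fderiv_apply_self {U : (EuclideanSpace ℝ (Fin 3)) → (EuclideanSpace ℝ (Fin 3))} {x : (EuclideanSpace ℝ (Fin 3))} (hU : DifferentiableAt ℝ U x) :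
    ContinuousLinearMap.adjoint (fderiv ℝ U x) (U x) = gradient (fun y => ‖U y‖ ^ 2 / 2) x := by
  apply ext_inner_right ℝ
  intro h
  rw [ContinuousLinearMap.adjoint_inner_left, inner_gradient_left,
    (hasFDerivAt_half_norm_sq hU).fderiv]
  simp

/-- **KILLSHEET XIII.0, adjoint remark**: for a Beltrami host `(U·∇)U = ∇(½|U|²) = (∇U)ᵀU`, so the
advective part `(U·∇)· − (∇U)ᵀ·` of the adjoint linearisation annihilates `U` itself
("L₀*U = P[(U·∇)U − (∇U)U] + νΔU = −νU since both brackets equal ∇|U|²/2"). -/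
theorem _root_.Literature.Analysis.FluidPDE.IsBeltrami.convect_sub_adjoint_apply_eq_zero
    {U : (EuclideanSpace ℝ (Fin 3)) → (EuclideanSpace ℝ (Fin 3))} {lam : (EuclideanSpace ℝ (Fin 3)) → ℝ} (hU : IsBeltrami U lam) {x : (EuclideanSpace ℝ (Fin 3))} (hUx : DifferentiableAt ℝ U x) :
    convect U U x - ContinuousLinearMap.adjoint (fderiv ℝ U x) (U x) = 0 := by
  rw [hU.convect_eq_gradient hUx, adjoint_fderiv_apply_self hUx, sub_self]

end Summit.NavierStokesRegularity.FluidComputer.BeltramiHostLinearisation
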